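import Mathlib
import HarnessLib

/-!
# Barrier: the scalar dyadic cascade is globally regular at three-dimensional scaling

Barrier catalogue `Literature/Barriers/NavierStokesRegularity/` (D-0021), entry for
`NavierStokesRegularity/NavierStokesRegularity` — an obstruction on the **blow-up side**
(routes aiming at the negation of `Literature.NS.NavierStokesExistenceSmoothR3` through a frequency
cascade). The Katz–Pavlović dyadic ("shell") model keeps one real amplitude per dyadic frequency
shell, the energy identity, and a nearest-neighbour quadratic transfer of energy towards high
frequencies; with dissipation of Navier–Stokes strength in three dimensions its non-negative
solutions do NOT blow up (Barbato–Morandin–Romito 2011), although they do for weaker dissipation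
(Cheskidov 2008). Tao (2016) records this as the reason his averaged blow-up had to be engineered
with a more complicated vector-valued circuit.

## What the sources print

* Barbato–Morandin–Romito 2011 (held arXiv text, §1.1 p. 3). The viscous problem (1.1):
  `Ẋₙ = -νλₙ² Xₙ + λ_{n-1}^β X_{n-1}² - λₙ^β Xₙ X_{n+1}`, `Xₙ(0) = xₙ`, `n ≥ 1`, `t ≥ 0`, "where
  `λ₀ = 0`, `λₙ = λⁿ` and `λ = 2`. We assume that `xₙ ≥ 0` and this implies (see [Che08]) that
  the solution remains positive at all times. The parameter `β` measures the relative strength of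
  the dissipation versus the non-linearity. The range of values `β ∈ (2, 5/2]` is essentially the
  one corresponding, within the simplification of the model, to the three dimensional
  Navier–Stokes equations"; "If `β ≤ 2` … Cheskidov [Che08] proved existence of regular global
  solutions using classical techniques, while if `β > 3` … all solutions with large enough
  initial condition develop a blow-up [Che08]. The two results above are based on 'energy methods'
  and do not cover the range `β ∈ (2, 5/2]`". **Theorem 1.** "Let `β ∈ (2, 5/2]`, then for every
  initial condition `(xₙ)_{n≥1}` such that `xₙ ≥ 0` for all `n ≥ 1`, and `∑ xₙ² < ∞`, there
  exists a unique solution to problem (1.1), which is smooth, that is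
  `sup_{n≥1} (λₙ^γ Xₙ(t)) < ∞` for all `γ > 0` and `t > 0`." §2, Lemma 2.1: an invariant region
  `A ⊂ ℝ²` for the pairs `(Yₙ, Y_{n+1})`, `Yₙ = λₙ^{β-2+ε} Xₙ`, independent of `ν ≥ 0`.
* Cheskidov 2008 (held arXiv text). §3, (3.1): `uₙ' + νλ^{2αn}uₙ - λⁿu_{n-1}² + λ^{n+1}uₙu_{n+1}
  = gₙ`, `n ≥ 1`, `u₀ = 0`, `λ > 1`, `ν > 0`, `α > 0`, force `g ∈ H = ℓ²` time-independent with
  `gₙ ≥ 0`; Def. 3.1: a (weak = classical) solution on `[T, ∞)` is an `H`-valued `u(t)` with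
  `uₙ ∈ C¹([T,∞))` satisfying (3.1) for all `n`; §1 p. 3: "for `α = 2/5` the following are sharp
  estimates on the inertial term: `|(B(u,u),Au)| ≲ |Au|^{3/2}|A^{1/2}u|^{3/2}` … The best known
  estimates on the inertial term of the 3D NSE are the same"; abstract: blow-up for `α < 1/3`,
  local regularity for `α > 1/3`, global regularity for `α ≥ 1/2`; **Thm. 4.4:** "If `α ≥ 1/2`,
  then for any `u⁰ ∈ V` there exists a strong solution `u(t)` to (3.1) on `[0,∞)` with
  `u(0) = u⁰`"; **Thm. 5.3:** "Let `u(t)` be a solution to (3.1) with `uₙ(0) ≥ 0` and `α < 1/3`.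
  Then for every `γ > 0`, there exists a constant `M(γ)`, such that `‖u(t)‖³_{1/3+γ}` is not
  locally integrable on `[0,∞)`, provided `‖u(0)‖_γ > M(γ)`" (here
  `‖u‖_γ² = ∑ λ^{2γn}uₙ²`, `V = H^α`). In Cheskidov's normalisation BMR's range `β ∈ (2, 5/2]`
  is `α = 1/β ∈ [2/5, 1/2)` (rescale the shell index).
* Tao 2016 (held arXiv text, §1.2 p. 9): the system `∂ₜXₙ = -λ^{2nα}Xₙ + λ^{n-1}X_{n-1}² -
  λⁿXₙX_{n+1}` "was introduced by Katz–Pavlovic (with `λ = 2` and `α = 2/5`) as a dyadic model for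
  the Navier–Stokes equations"; "Blowup solutions … are known to exist for sufficiently small `α`;
  specifically, for `α < 1/4` this was (essentially) established in [katz-dyadic], while for
  `α < 1/3` this was established in [ches], with global regularity established in the critical
  and subcritical regimes `α ≥ 1/2`. If a blowup solution could be constructed with the value
  `α = 2/5`, then this would be a dyadic analogue of Theorem 1.5. Unfortunately for our purposes,
  for the values `λ = 2^{1/α}`, `α = 2/5`, global regularity was established in [bmr] (for
  non-negative initial data `Xₙ(0)`), by carefully identifying a region of phase space that is
  invariant …, and which in particular prevents the energy `Xₙ` from concentrating too strongly
  at a single value of `n`. However, the argument in [bmr] is sensitive to the specific numerical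
  value of `λ` (and also relies heavily on the assumption of initial non-negativity), and does not
  rule out the possibility of blowup at `α = 2/5` for some variant of the system"; "this cascade
  scenario does not actually occur as strongly as the above heuristic reasoning suggests, because
  the energy in `X_{n+1}` is partially transferred to `X_{n+2}` before the transfer of energy from
  `Xₙ` to `X_{n+1}` is fully complete"; p. 10: the remedy — exogenous truncation (Prop. 5.1) or
  the vector-valued "quadratic circuits" with pump, amplifier and rotor gates (Thm. 6.2 ⇒ Thm. 1.5).

## Formal content

Namespace `Literature.Barriers.NavierStokesRegularity.Dyadic`: the explicit ODE systems
(`bmrLambda`, `bmrRHS`, `IsBMRWeakSolution`; `cheskidovRHS`, `IsCheskidovSolution`, the weighted norms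
`dyadicNormSq`), the named facts (not proved here) `BarbatoMorandinRomito2011_thm1`,
`Cheskidov2008_thm44`, `Cheskidov2008_thm53` (the latter in the range `0 < γ < min{1/3, 1-3α}` its
proof covers), and the catalogue entry
`DyadicCascadeRegularity := BarbatoMorandinRomito2011_thm1`. All three facts are precise statements
about explicit countable ODE systems and are formalisable targets (BMR's proof is a
two-dimensional invariant-region argument plus a smoothing proposition); all three are now PROVED
in sibling files of this catalogue (see the audit below), and the corollary
`DyadicCascadeRegularity.weakSolution_smooth` (every weak solution from a non-negative `ℓ²` datum
at `β = 5/2` is smooth for `t > 0`) is the form in which refuters consume the entry.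

## Audit (barrier audit, 2026-08-16; docstring sharpening plus one corollary, declarations unchanged)

* Formal status. The three named facts are machine-checked in the tree:
  `Dyadic.BarbatoMorandinRomito2011_thm1_holds` and `dyadicCascadeRegularity_holds`
  (`DyadicCascadeRegularityBMRProofs.lean`, assembling `DyadicCascadeExistence`,
  `DyadicCascadePositivity`, `DyadicCascadeUniqueness`, `DyadicSmoothing`, `DyadicInvariantRegion`,
  `DyadicInvariantRegionNumerics`, `DyadicInvariantRegionScaling`), `Dyadic.Cheskidov2008_thm44_holds`
  (`DyadicCascadeRegularityProofs.lean`) and `Dyadic.Cheskidov2008_thm53_holds`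
  (`DyadicCascadeBlowupProofs.lean`); axioms `propext`, `Classical.choice`, `Quot.sound`. The
  transcription was re-read against the held text (Thm. 1 pp. 2–3; Def. 3.1, Prop. 3.2 p. 5; proof
  of Thm. 1 pp. 7–8: the `ℓ²` datum is handled through the energy inequality — `supₙ λₙXₙ(t₀) < ∞`
  for a.e. `t₀`, whence `K₀ = supₙ λₙ^{β-2+ε}Xₙ(t₀) < ∞` because `β - 2 + ε ≤ 1` — a rescaling into
  the region, Lemma 2.1, and the smoothing Prop. 3.3). So the audit concerns only the metadata
  (technique class and scope) of the structured block.
* Technique class: what is covered is ONE model. Lemma 2.1 is certified for the shell ratio `λ = 2`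
  only: the lower curve of the region is `h(x) = c((x-δ)/(1-δ))^{λ²}`, the corner condition is
  `λ^γ c = 1`, and "a direct computation shows that both `ψ₁` and `ψ₂` are positive with the choice
  `δ = 1/10`, `θ = 3/5`, `m = 3/4`" (held text pp. 4–5; in the tree `Dyadic.invariantRegion_le_one`
  carries the windows `κₙ₊₁ ≤ 4κₙ`, `L ≥ 3.972`, `c ≤ 0.511`, `Lc ≤ 2.03` and the exponent `4`,
  which for `Fₙ₊₁/Fₙ = λ^{2-ε}`, `c = λ^{-γ}` pin `λ` to `2`). Dictionary: BMR's `(λ, β, ν)` is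
  Cheskidov's/Tao's `λⁿ`-normalisation with base `λ^β` and `α = 1/β`, so the theorem covers the
  single base `2^{5/2}` at `α = 2/5` ("for the values `λ = 2^{1/α}`, `α = 2/5`"
  [cite: Tao2016AveragedNS, §1.2 p. 9]) — which IS the original Katz–Pavlović cube model (cascade
  coefficient `2^{5j/2}`, Laplacian `2^{2j}`) [cite: Cheskidov2008, §2] — and not the rest of
  Cheskidov's family `λ > 1` at `α = 2/5`, for which his own Theorems 4.4 and 5.3 are stated;
  Filonov–Khodunov quote BMR with "`λ = 2`, `2 < β ≤ 5/2`" and record that strong solutions for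
  sign-changing data and the strength of Leray–Hopf solutions for `2 < β ≤ 3` are open
  [cite: FilonovKhodunov2021, Introduction]; the 2023 survey states the gap `1/3 ≤ γ < 2/5` and
  conjectures that "solutions of the viscous dyadic model cannot have a blow-up worse than
  Onsager's", i.e. regularity for every `γ > 1/3` and every base
  [cite: CheskidovDaiFriedlander2023, §3.2.1]. In BMR's critical variables `Yₙ = λₙ^{β-2}Xₙ` the
  model is `Ẏₙ = λ^{2n+β-4}(-νλ^{4-β}Yₙ + Y²ₙ₋₁ - λ^{6-2β}YₙYₙ₊₁)` (their (2.1) with `ε = 0`)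
  [cite: BarbatoMorandinRomito2011, §2 (2.1)]: at fixed `β` the shell ratio is a genuine second
  parameter, and blow-up at `β = 5/2` for some ratio would need a cascade front whose `Y`-amplitude
  does not decay along `n` (heuristically, along the Kolmogorov/Onsager profile `Xₙ ~ (λ^β)^{-n/3}`
  of the inviscid cascade the `Y`-amplitude decays by `λ^{2β/3-2}` per shell, `< 1` exactly when
  `β < 3`, Cheskidov's threshold) [cite: CheskidovDaiFriedlander2023, §3.1.4 and §3.2.1]. For a
  Fourier-space realisation the KP "low-low → high" interaction `P_k div(u_{k-1} ⊗ u_{k-1})`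
  cannot separate shells by much more than a factor `2` [cite: Palasek2026ElementaryModel, §4], so
  ratio `2` is also the physically maximal case of the pump cascade. Hence the tags are narrowed below to the
  unforced KP pump coupling on geometric shells of ratio `2` with non-negative data.
* The wider tags are NOT covered — a 2026 theorem sits in the gap. For the FORCED Obukhov
  ("amplifier") model `X_k' = -νN_k²X_k + N_{k-1}^αX_{k-1}X_k - N_k^αX_{k+1}² + f_k` on
  super-exponentially separated shells `N_k = N₀^{b^k}`, every `α > 2` — in particular the
  three-dimensional window `α ∈ (2, 5/2]` — admits positive `C^∞` data and a `C_t^∞C^∞` force,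
  vanishing in every `C^s` as `t → T_*`, whose solution blows up in finite time (Type II): a scalar,
  one-mode-per-shell, nearest-neighbour, positive, low-to-high cascade at three-dimensional scaling
  that blows up [cite: Palasek2026ElementaryModel, Thm. 1.3, Rem. 1.4–1.7 and §1.3]. The force is
  necessary in that model (the unforced viscous Obukhov model at `d = 3` is reported globally
  regular — Looi, to appear 2026, announced there, not yet in print) and the super-exponential
  spacing "probably necessary" [cite: Palasek2026ElementaryModel, §1.1, Rem. 1.4 and Rem. 1.6].
  Related results inside the wide tags and outside the theorem: Obukhov coupling, `d = 3` scaling,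
  large ratio — two distinct non-negative Leray–Hopf solutions from critical data, both smooth for
  `t > 0` (ill-posedness, no blow-up) [cite: Palasek2024LerayHopfDyadic, Thm. 1.2 and Rem. 1.4]; KP
  coupling with rough forcing, `β > 2` — two Leray–Hopf solutions
  [cite: FilonovKhodunov2021, Thm. 0.6]; KP coupling, all ratios and signs — Leray–Hopf uniqueness
  for `β ≤ 2`, or `β > 2` with data `o(λ^{(2-β)n})` [cite: Filonov2017, main theorem, quoted as Thm. 0.4 of FilonovKhodunov2021].
* Verdict: statement CONFIRMED (machine-checked); technique class NARROWED (tags); `scope_caveats`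
  (ii), (iv) and `evasions_known` updated accordingly. The summit statement in the tree is Clay (A)
  with `f ≡ 0`, so the forced evasion bears on model-building and on forced variants, not directly
  on `¬NavierStokesRegularity`.

## References

* D. Barbato, F. Morandin, M. Romito, *Smooth solutions for the dyadic model*, Nonlinearity 24
  (2011), 3083–3097, Thm. 1, Lemma 2.1. [`BarbatoMorandinRomito2011`]
* A. Cheskidov, *Blow-up in finite time for the dyadic model of the Navier–Stokes equations*,
  Trans. Amer. Math. Soc. 360 (2008), 5101–5120, §3, Thms. 4.3, 4.4, 5.3. [`Cheskidov2008`]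
* T. Tao, J. Amer. Math. Soc. 29 (2016), §1.2 pp. 8–10, Prop. 5.1, Thm. 6.2. [`Tao2016AveragedNS`]
* S. Palasek, *Finite-time blow-up in an elementary model of the 3D Navier–Stokes equations*,
  arXiv:2605.13827 (2026), §1.1, Thm. 1.3, Rem. 1.4–1.7, §1.3, §4. [`Palasek2026ElementaryModel`]
* S. Palasek, *Non-uniqueness in the Leray–Hopf class for a dyadic Navier–Stokes model*,
  arXiv:2407.06179 (2024), Thm. 1.2, Rem. 1.4–1.5. [`Palasek2024LerayHopfDyadic`]
* N. Filonov, P. Khodunov, *Nonuniqueness of Leray–Hopf solutions for a dyadic model*,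
  St. Petersburg Math. J. 32 (2021), 371–387, Introduction, Thms. 0.4–0.6. [`FilonovKhodunov2021`]
* N. Filonov, *Uniqueness of the Leray–Hopf solution for a dyadic model*, Trans. Amer. Math. Soc.
  369 (2017), 8663–8684. [`Filonov2017`]
* A. Cheskidov, M. Dai, S. Friedlander, *Dyadic models for fluid equations: a survey*, J. Math.
  Fluid Mech. 25 (2023), Paper 62, §3.1.4, §3.2.1. [`CheskidovDaiFriedlander2023`]
-/

noncomputable section

open Set Filter Topology

namespace Literature.Barriers.NavierStokesRegularity

namespace Dyadic

/-! ### The Barbato–Morandin–Romito (Katz–Pavlović) viscous dyadic model -/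

/-- The wave numbers of BMR (1.1): `λ₀ = 0` and `λₙ = λⁿ` for `n ≥ 1`, with `λ = 2`.
[cite: BarbatoMorandinRomito2011, §1.1 (1.1)] -/
def bmrLambda (n : ℕ) : ℝ :=
  if n = 0 then 0 else 2 ^ n

/-- `λ₀ = 0`. [cite: BarbatoMorandinRomito2011, §1.1 (1.1)] -/
@[simp] theorem bmrLambda_zero : bmrLambda 0 = 0 := by simp [bmrLambda]

/-- `λₙ = 2ⁿ` for `n ≥ 1`. [cite: BarbatoMorandinRomito2011, §1.1 (1.1)] -/
theorem bmrLambda_of_ne_zero {n : ℕ} (hn : n ≠ 0) : bmrLambda n = 2 ^ n := by simp [bmrLambda, hn]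

/-- The wave numbers are non-negative. [folklore] -/
theorem bmrLambda_nonneg (n : ℕ) : 0 ≤ bmrLambda n := by
  unfold bmrLambda; split_ifs <;> positivity

/-- The right-hand side of BMR (1.1) at mode `n ≥ 1` for the amplitude vector `X : ℕ → ℝ`:
`-ν λₙ² Xₙ + λ_{n-1}^β X_{n-1}² - λₙ^β Xₙ X_{n+1}` (real powers `λ^β`; at `n = 1` the input term
vanishes because `λ₀ = 0` and `β > 0`, whatever the fictitious value `X 0`).
[cite: BarbatoMorandinRomito2011, §1.1 (1.1)] -/
def bmrRHS (ν β : ℝ) (X : ℕ → ℝ) (n : ℕ) : ℝ :=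
  -ν * bmrLambda n ^ 2 * X n + bmrLambda (n - 1) ^ β * X (n - 1) ^ 2 -
    bmrLambda n ^ β * X n * X (n + 1)

/-- At the first mode the forcing from below vanishes (`λ₀^β = 0` for `β ≠ 0`). [folklore] -/
theorem bmrRHS_one {ν β : ℝ} (hβ : β ≠ 0) (X : ℕ → ℝ) :
    bmrRHS ν β X 1 = -ν * bmrLambda 1 ^ 2 * X 1 - bmrLambda 1 ^ β * X 1 * X 2 := by
  simp [bmrRHS, Real.zero_rpow hβ]

/-- **Weak solutions of the BMR viscous dyadic model** with datum `x` (Barbato–Morandin–Romito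
2011, §3 Def. 3.1: "A weak solution to (1.1) on `[0,T]` is a sequence of functions `X = (Xₙ)_{n≥1}`
such that `Xₙ ∈ C¹([0,T];ℝ)` for every `n ≥ 1` and (1.1) is satisfied"; here on `[0, ∞)`):
`X : ℕ → ℝ → ℝ` (mode, time) with `Xₙ(0) = xₙ` and each `Xₙ`, `n ≥ 1`, differentiable on `[0,∞)`
(one-sided at `0`) with derivative `bmrRHS ν β (X · t) n` (continuity of the derivative is then
automatic). No `ℓ²` requirement, exactly as printed; a *Leray–Hopf* solution is a weak solution
with values in `H = ℓ²` obeying the energy inequality, and for non-negative data "every weak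
solution is a Leray–Hopf solution, stays positive for all times" (BMR §3, from [Che08];
Cheskidov's Thm. 4.2). The fictitious mode `X 0` is unconstrained (it never enters, `λ₀ = 0`).
[cite: BarbatoMorandinRomito2011, §3 Def. 3.1] [cite: Cheskidov2008, §3 Def. 3.1 and §4 Thm. 4.2] -/
def IsBMRWeakSolution (ν β : ℝ) (x : ℕ → ℝ) (X : ℕ → ℝ → ℝ) : Prop :=
  (∀ n, 1 ≤ n → X n 0 = x n) ∧
    ∀ n, 1 ≤ n → ∀ t, 0 ≤ t →
      HasDerivWithinAt (X n) (bmrRHS ν β (fun m => X m t) n) (Ici 0) t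

/-- **Barbato–Morandin–Romito 2011, Theorem 1**, as printed: let `β ∈ (2, 5/2]` (the range
"corresponding … to the three dimensional Navier–Stokes equations"), `λ = 2` and `ν > 0`; then
for every initial condition with `xₙ ≥ 0` for all `n ≥ 1` and `∑ xₙ² < ∞` "there exists a unique
solution to problem (1.1), which is smooth, that is `sup_{n≥1} (λₙ^γ Xₙ(t)) < ∞` for all `γ > 0`
and `t > 0`." Transcription: a weak solution (`IsBMRWeakSolution`, BMR Def. 3.1) exists which is
`ℓ²`-valued, non-negative (BMR §3 second bullet, from Cheskidov's Thm. 4.2) and smooth in the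
printed sense, and it is unique among ALL weak solutions with the same datum (Thm. 1 with §3
Prop. 3.2: "if `β ≤ 3`, there is a unique weak solution for any positive initial condition in
`H`"). Named fact; proved in the tree (`BarbatoMorandinRomito2011_thm1_holds`, sibling file
`DyadicCascadeRegularityBMRProofs.lean`). [cite: BarbatoMorandinRomito2011, §1.1 Thm. 1 and §3 Prop. 3.2]
[cite: Cheskidov2008, §4 Thm. 4.2] -/
def BarbatoMorandinRomito2011_thm1 : Prop :=
  ∀ ν β : ℝ, 0 < ν → 2 < β → β ≤ 5 / 2 →
    ∀ x : ℕ → ℝ, (∀ n, 1 ≤ n → 0 ≤ x n) → Summable (fun n => x n ^ 2) →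
      ∃ X : ℕ → ℝ → ℝ, IsBMRWeakSolution ν β x X ∧
        (∀ t, 0 ≤ t → Summable fun n => X n t ^ 2) ∧
        (∀ n, 1 ≤ n → ∀ t, 0 ≤ t → 0 ≤ X n t) ∧
        (∀ γ : ℝ, 0 < γ → ∀ t : ℝ, 0 < t → ∃ C : ℝ, ∀ n, 1 ≤ n → bmrLambda n ^ γ * X n t ≤ C) ∧
        ∀ Y : ℕ → ℝ → ℝ, IsBMRWeakSolution ν β x Y → ∀ n, 1 ≤ n → ∀ t, 0 ≤ t → Y n t = X n t

/-! ### Cheskidov's normalisation: dissipation degree `α` -/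

/-- The right-hand side of Cheskidov's dyadic model (3.1) at mode `n ≥ 1`,
`uₙ' = -νλ^{2αn}uₙ + λⁿu_{n-1}² - λ^{n+1}uₙu_{n+1} + gₙ`, with the convention `u₀ = 0` enforced by
the solution predicate. [cite: Cheskidov2008, §3 (3.1)] -/
def cheskidovRHS (lam ν α : ℝ) (g : ℕ → ℝ) (u : ℕ → ℝ) (n : ℕ) : ℝ :=
  -ν * lam ^ (2 * α * n) * u n + lam ^ n * u (n - 1) ^ 2 - lam ^ (n + 1) * u n * u (n + 1) + g n

/-- The squared weighted norm `‖u‖_γ² = ∑_{n≥1} λ^{2γn} uₙ²` of Cheskidov's scale `H^γ`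
(§3: `((u,v))_γ = ∑ λ^{2γn}uₙvₙ`; `γ = 0`: the energy norm of `H = ℓ²`; `γ = α`: the "enstrophy"
norm of `V`), as an extended real so that divergence is visible. [cite: Cheskidov2008, §3] -/
def dyadicNormSq (lam γ : ℝ) (u : ℕ → ℝ) : ENNReal :=
  ∑' n : ℕ, if n = 0 then 0 else ENNReal.ofReal (lam ^ (2 * γ * n) * u n ^ 2)

/-- **Solutions of Cheskidov's model** (Def. 3.1: "an `H`-valued function `u(t)` defined for
`t ∈ [T,∞)`, such that `uₙ ∈ C¹([T,∞))` and `uₙ(t)` satisfies (3.1) for all `n`"; here `T = 0`):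
`u 0 ≡ 0`, `uₙ(0) = u⁰ₙ`, each `uₙ` has the derivative prescribed by (3.1) on `[0,∞)` (one-sided
at `0`), and `u(t) ∈ ℓ²` for all `t ≥ 0`. Parameters: `λ > 1`, `ν > 0`, `α > 0`, force `g`.
[cite: Cheskidov2008, §3 Def. 3.1 and (3.1)] -/
def IsCheskidovSolution (lam ν α : ℝ) (g : ℕ → ℝ) (u0 : ℕ → ℝ) (u : ℕ → ℝ → ℝ) : Prop :=
  (∀ t, u 0 t = 0) ∧ (∀ n, 1 ≤ n → u n 0 = u0 n) ∧
    (∀ n, 1 ≤ n → ∀ t, 0 ≤ t →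
      HasDerivWithinAt (u n) (cheskidovRHS lam ν α g (fun m => u m t) n) (Ici 0) t) ∧
    ∀ t, 0 ≤ t → Summable fun n => u n t ^ 2

/-- **Cheskidov 2008, Theorem 4.4** (global regularity in the critical and subcritical regimes):
"If `α ≥ 1/2`, then for any `u⁰ ∈ V` there exists a strong solution `u(t)` to (3.1) on `[0,∞)`
with `u(0) = u⁰`" — strong = the enstrophy norm `‖u(t)‖ = ‖u(t)‖_α` is bounded on every
`[0, T₂]`; standing hypotheses `λ > 1`, `ν > 0`, `g ∈ H` time-independent with `gₙ ≥ 0`.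
Named fact; proved in the tree (`Cheskidov2008_thm44_holds`, sibling file
`DyadicCascadeRegularityProofs.lean`). [cite: Cheskidov2008, §4 Thm. 4.4] -/
def Cheskidov2008_thm44 : Prop :=
  ∀ lam ν α : ℝ, 1 < lam → 0 < ν → 1 / 2 ≤ α →
    ∀ g : ℕ → ℝ, (∀ n, 1 ≤ n → 0 ≤ g n) → Summable (fun n => g (n + 1) ^ 2) →
    ∀ u0 : ℕ → ℝ, dyadicNormSq lam α u0 < ⊤ →
      ∃ u : ℕ → ℝ → ℝ, IsCheskidovSolution lam ν α g u0 u ∧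
        ∀ T : ℝ, 0 ≤ T → ∃ C : ENNReal, C < ⊤ ∧ ∀ t ∈ Icc 0 T, dyadicNormSq lam α (fun n => u n t) ≤ C

/-- **Cheskidov 2008, Theorem 5.3** (finite-time blow-up for weak dissipation), transcribed in the
range its printed proof covers. Printed: "Let `u(t)` be a solution to (3.1) with `uₙ(0) ≥ 0` and
`α < 1/3`. Then for every `γ > 0`, there exists a constant `M(γ)`, such that `‖u(t)‖³_{1/3+γ}` is
not locally integrable on `[0,∞)`, provided `‖u(0)‖_γ > M(γ)`" (standing hypotheses `λ > 1`,
`ν > 0`, `α > 0`, `g ∈ H` time-independent with `gₙ ≥ 0`). The proof (p. 9) begins "it is enough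
to prove the theorem in the case `0 < γ < min{1/3, 1-3α}`" and establishes exactly that case
(Lemma 5.1 is stated for `γ ∈ (0, 1-3α)`; the force term is handled for `γ ≤ 1/3`); since
`‖u(0)‖_{γ'} ≤ ‖u(0)‖_γ` only for `γ' ≤ γ`, that reduction transfers the conclusion but not the
LARGENESS hypothesis to small `γ`. Transcription note (not in the source, recorded at review of
this entry): without the restriction the sentence fails for large `γ` — for `g = 0`, `γ > 2` and
the datum `u⁰ = λ^{-2N} e_N` one has `‖u⁰‖_γ² = λ^{(2γ-4)N} → ∞` while the (non-negative) solution
obeys `u_m ≤ λ^{(1-2α)m} (sup u_{m-1})²/ν` above shell `N`, a doubly-exponentially decaying bound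
that keeps every `‖u(t)‖_{1/3+γ}` bounded uniformly in `t`. Hence the vendored statement carries the
hypotheses `γ < 1/3` and `γ < 1 - 3α`. "Not locally integrable on `[0,∞)`" is read as: on some
bounded `[0, T]` the lower integral of `‖u(t)‖³_{1/3+γ}` (valued in `[0,∞]`) is infinite; the
constant may depend on `λ, ν, α, g, γ`. Named fact; proved in the tree (`Cheskidov2008_thm53_holds`,
sibling file `DyadicCascadeBlowupProofs.lean`).
[cite: Cheskidov2008, §5 Thm. 5.3, Lemma 5.1 and the first lines of the proof] -/
def Cheskidov2008_thm53 : Prop :=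
  ∀ lam ν α : ℝ, 1 < lam → 0 < ν → 0 < α → α < 1 / 3 →
    ∀ g : ℕ → ℝ, (∀ n, 1 ≤ n → 0 ≤ g n) → Summable (fun n => g (n + 1) ^ 2) →
    ∀ γ : ℝ, 0 < γ → γ < 1 / 3 → γ < 1 - 3 * α → ∃ M : ENNReal, M < ⊤ ∧
      ∀ (u0 : ℕ → ℝ) (u : ℕ → ℝ → ℝ), (∀ n, 1 ≤ n → 0 ≤ u0 n) →
        IsCheskidovSolution lam ν α g u0 u → M < dyadicNormSq lam γ u0 →
        ∃ T : ℝ, 0 < T ∧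
          ∫⁻ t in Icc 0 T, dyadicNormSq lam (1 / 3 + γ) (fun n => u n t) ^ (3 / 2 : ℝ) = ⊤

end Dyadic

open NavierStokesRegularity.Dyadic

/-- **Barrier (Barbato–Morandin–Romito 2011; Cheskidov 2008; as read by Tao 2016): at
three-dimensional Navier–Stokes scaling the scalar dyadic energy cascade does not blow up.**
For `β ∈ (2, 5/2]`, `λ = 2`, `ν > 0` and every non-negative square-summable datum the viscous
dyadic model `Ẋₙ = -νλₙ²Xₙ + λ_{n-1}^βX_{n-1}² - λₙ^βXₙX_{n+1}` has a global weak solution which is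
smooth (`sup_n λₙ^γXₙ(t) < ∞` for all `γ > 0`, `t > 0`), non-negative, and unique among all weak
solutions (C¹ components solving the system). Definitionally the named fact
`Dyadic.BarbatoMorandinRomito2011_thm1` (proved in the tree: `dyadicCascadeRegularity_holds` in the
sibling file `DyadicCascadeRegularityBMRProofs.lean`).
[cite: BarbatoMorandinRomito2011, §1.1 Thm. 1]

BARRIER (structured block, D-0021):
- technique_class: dyadic-cascade-blowup, katz-pavlovic-nearest-neighbour-transfer, kp-pump-cascade-at-3d-scaling-ratio-2, unforced-scalar-one-mode-per-shell-pump-cascade — blow-up constructions (for the NEGATION of NavierStokesRegularity) whose mechanism is the UNFORCED scalar nearest-neighbour low-to-high "pump" cascade (feed `λ_{n-1}^βX_{n-1}²`, drain `λₙ^βXₙX_{n+1}`) of the Katz–Pavlović dyadic model on geometric shells of ratio `2` (`λₙ = 2ⁿ` carrying the nonlinearity `λₙ^{5/2}`; the single base `2^{5/2}` of Cheskidov's/Tao's `λⁿ`-normalisation at `α = 2/5`; the original Katz–Pavlović cube model) with non-negative amplitudes and dissipation of three-dimensional Navier–Stokes strength ("If a blowup solution could be constructed with the value `α = 2/5`,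 then this would be a dyadic analogue of Theorem 1.5"; "for the values `λ = 2^{1/α}`, `α = 2/5`, global regularity was established in [bmr]") [cite: Tao2016AveragedNS, §1.2 p. 9] [cite: BarbatoMorandinRomito2011, §1.1] [cite: Cheskidov2008, §2]; audit 2026-08-16: the wider tags formerly listed here (`shell-model-blowup-at-3d-scaling`, `monotone-low-to-high-energy-cascade`, `scalar-one-mode-per-shell`) are NOT covered — a forced scalar Obukhov cascade at three-dimensional scaling blows up [cite: Palasek2026ElementaryModel, Thm. 1.3] — and are to be read as "KP pump coupling, unforced, ratio `2`, non-negative data" only (see `evasions_known`, `scope_caveats` (ii))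
- blocks: the first step of Tao's blow-up programme for `¬ Literature.NS.NavierStokesExistenceSmoothR3` (a dyadic/shell model at three-dimensional scaling exhibiting blow-up, to be embedded into the true nonlinearity) when carried out with the unmodified, unforced scalar Katz–Pavlović model at shell ratio `2`; in-tree this concerns the blow-up theses of `Summits/NavierStokesRegularity/NavierStokesRegularity/Theses/` (`Blowup`, `CertifiedBlowup`) only insofar as they run through such a cascade [cite: Tao2016AveragedNS, §1.2 pp. 9–10]
- because: in the range `β ∈ (2, 5/2]` (Cheskidov's `α = 1/β ∈ [2/5, 1/2)`, where `α = 2/5` carries "the same" sharp estimates on the inertial term as the 3D Navier–Stokes equations [cite: Cheskidov2008, §1 p. 3]) the pairs `(λₙ^{β-2+ε}Xₙ, λ_{n+1}^{β-2+ε}X_{n+1})` stay in a bounded invariant region, which forces smoothness [cite: BarbatoMorandinRomito2011, §2 Lemma 2.1 and Thm. 1]; dynamically, "the energy in `X_{n+1}` is partially transferred to `X_{n+2}` before the transfer of energy from `Xₙ` to `X_{n+1}` is fully complete, leading instead to a solution in which the bulk of the energy remains in low values of `n` and is eventually dissipated away" [cite: Tao2016AveragedNS, §1.2 p. 9]; blow-up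 of the scalar model is known only for weaker dissipation, `α < 1/3` [cite: Cheskidov2008, §5 Thm. 5.3], while energy methods give global regularity for `α ≥ 1/2` [cite: Cheskidov2008, §4 Thm. 4.4] and the intermediate range, other values of `λ` and sign-changing data are not settled by these results [cite: Tao2016AveragedNS, §1.2 p. 9]; the invariant region is certified at `λ = 2` only (`δ = 1/10`, `θ = 3/5`, `m = 3/4`, lower-curve exponent `λ² = 4`, corner condition `λ^γc = 1`, "a direct computation shows that both `ψ₁` and `ψ₂` are positive"; in the tree `Dyadic.invariantRegion_le_one` with numeric windows pinning `λ` to `2`) [cite: BarbatoMorandinRomito2011, §2 proof of Lemma 2.1 and Rem. 2.2]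
- evasions_known: modify the model — exogenously truncated interactions blow up for every supercritical `α < 1/2` [cite: Tao2016AveragedNS, §5.2 Prop. 5.1]; Tao's vector-valued dyadic system with four modes per shell ("pump", "amplifier" and "rotor" gates producing a delayed, abrupt energy transfer) has no global solution at three-dimensional scaling and yields the averaged Navier–Stokes blow-up, catalogue entry `TaoAveragedBlowup` [cite: Tao2016AveragedNS, §6 Thm. 6.2 and §1.1 Thm. 1.5]; the regularity argument "is sensitive to the specific numerical value of `λ` (and also relies heavily on the assumption of initial non-negativity), and does not rule out the possibility of blowup at `α = 2/5` for some variant of the system" [cite: Tao2016AveragedNS, §1.2 p. 9]; audit 2026-08-16 — change the gate and the shell spacing and allow a smooth force: for the FORCED Obukhov ("amplifier") model `X_k' = -νN_k²X_k + N_{k-1}^αX_{k-1}X_k - N_k^αX_{k+1}² + f_k` on super-exponentially separated shells `N_k = N₀^{b^k}`, every `α > 2`, in particular the three-dimensional window `α ∈ (2, 5/2]`, admits positive `C^∞` data and a `C_t^∞C^∞` force vanishing in every `C^s` as `t → T_*` with finite-time (Type II) blow-up — a scalar, one-mode-per-shell, nearest-neighbour, positive, low-to-high cascade at three-dimensional scaling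 that blows up [cite: Palasek2026ElementaryModel, Thm. 1.3, Rem. 1.4–1.7 and §1.3]; there the force only "sets the stage" (it switches off the dissipation of each mode before its activation) and is necessary — the unforced viscous Obukhov model at `d = 3` is reported globally regular (Looi, to appear, announced ibid.; not yet in print) — and the super-exponential spacing is "probably necessary" [cite: Palasek2026ElementaryModel, §1.3.2, Rem. 1.4 and Rem. 1.6]; the tree's summit statement is Clay (A) with `f ≡ 0`, so this evasion reaches forced variants and the model-building step, not `¬NavierStokesRegularity` itself
- scope_caveats: (i) a theorem about an ODE model, not about Navier–Stokes; it obstructs a model-building step, not a PDE argument [cite: Tao2016AveragedNS, §1.2 p. 9]; (ii) only `λ = 2`, `β ∈ (2, 5/2]`, non-negative data, no force, the scalar Katz–Pavlović interaction; sign-changing data, other values of `λ`, forced models and other shell models (e.g. Obukhov-type couplings) are not covered [cite: BarbatoMorandinRomito2011, §1.1 Thm. 1] [cite: Tao2016AveragedNS, §1.2 p. 9]; audit 2026-08-16: no regularity theorem for another shell ratio at `β = 5/2` is in print — the survey states the gap `1/3 ≤ γ < 2/5` and conjectures regularity for every `γ > 1/3` ("cannot have a blow-up worse than Onsager's") [cite: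 CheskidovDaiFriedlander2023, §3.2.1], Filonov–Khodunov quote the theorem with `λ = 2` and record strong solutions for sign-changing data and the strength of Leray–Hopf solutions for `2 < β ≤ 3` as open [cite: FilonovKhodunov2021, Introduction], and Katz–Pavlović regularity is "known only when `f = 0`" (conjecturally stable under smooth forcing) [cite: Palasek2026ElementaryModel, §1.1]; a KP cascade realised in Fourier space cannot separate shells by much more than a factor `2` [cite: Palasek2026ElementaryModel, §4], so ratio `2` is the physically maximal pump case; inside the wide tags but outside the theorem: Obukhov coupling at `d = 3` scaling with large ratio has two distinct non-negative Leray–Hopf solutions from critical data, both smooth for `t > 0` (no blow-up) [cite: Palasek2024LerayHopfDyadic, Thm. 1.2 and Rem. 1.4], the KP model with rough forcing and `β > 2` has two Leray–Hopf solutions [cite: FilonovKhodunov2021, Thm. 0.6], and Leray–Hopf uniqueness holds for all ratios and signs when `β ≤ 2`, or `β > 2` with data `o(λ^{(2-β)n})` [cite: Filonov2017, main theorem]; (iii) uniqueness in BMR Thm. 1 is transcribed in the class of ALL weak solutions of BMR Def. 3.1 (C¹ components solving (1.1)), as §3 Prop. 3.2 prints for `β ≤ 3` and positive `ℓ²` data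 [cite: BarbatoMorandinRomito2011, §3 Def. 3.1 and Prop. 3.2]; Cheskidov's facts carry his standing hypotheses (`λ > 1`, `ν > 0`, time-independent `g ∈ ℓ²`, `gₙ ≥ 0`), "not locally integrable" is rendered as an infinite lower integral on some `[0,T]`, and Thm. 5.3 is transcribed ONLY for `0 < γ < min{1/3, 1-3α}`, the range its proof establishes (the printed "for every `γ > 0`" is not: the opening reduction to small `γ` does not transport the largeness hypothesis, and tiny data on one high shell refute the unrestricted sentence) [cite: Cheskidov2008, §5 Lemma 5.1 and proof of Thm. 5.3]; (iv) audit 2026-08-16: all three named facts are PROVED in the tree (`dyadicCascadeRegularity_holds`, `Dyadic.Cheskidov2008_thm44_holds`, `Dyadic.Cheskidov2008_thm53_holds` in the sibling files `DyadicCascadeRegularityBMRProofs`, `DyadicCascadeRegularityProofs`, `DyadicCascadeBlowupProofs`; standard axioms)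
- status: established (machine-checked in the tree) -/
def DyadicCascadeRegularity : Prop :=
  Dyadic.BarbatoMorandinRomito2011_thm1

/-- The catalogue entry is BMR's Theorem 1 (existence, positivity, smoothness and uniqueness
clauses), by definition. [cite: BarbatoMorandinRomito2011, §1.1 Thm. 1 and §3 Prop. 3.2] -/
theorem dyadicCascadeRegularity_iff :
    DyadicCascadeRegularity ↔ Dyadic.BarbatoMorandinRomito2011_thm1 :=
  Iff.rfl

/-- Consequence at the Katz–Pavlović/Tao value `β = 5/2` (Cheskidov's `α = 2/5`, the
three-dimensional scaling): every non-negative `ℓ²` datum launches a global solution all of whose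
weighted suprema `sup_n λₙ^γ Xₙ(t)` are finite for `t > 0`, unique among weak solutions — no weak
solution from such a datum blows up along the scalar cascade. [cite: BarbatoMorandinRomito2011, §1.1 Thm. 1] [cite: Tao2016AveragedNS, §1.2 p. 9] -/
theorem DyadicCascadeRegularity.at_three_dimensional_scaling (h : DyadicCascadeRegularity)
    {ν : ℝ} (hν : 0 < ν) (x : ℕ → ℝ) (hx : ∀ n, 1 ≤ n → 0 ≤ x n)
    (hx2 : Summable fun n => x n ^ 2) :
    ∃ X : ℕ → ℝ → ℝ, IsBMRWeakSolution ν (5 / 2) x X ∧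
      (∀ γ : ℝ, 0 < γ → ∀ t : ℝ, 0 < t → ∃ C : ℝ, ∀ n, 1 ≤ n → bmrLambda n ^ γ * X n t ≤ C) ∧
      ∀ Y : ℕ → ℝ → ℝ, IsBMRWeakSolution ν (5 / 2) x Y → ∀ n, 1 ≤ n → ∀ t, 0 ≤ t → Y n t = X n t := by
  obtain ⟨X, hsol, -, -, hsmooth, huniq⟩ := h ν (5 / 2) hν (by norm_num) le_rfl x hx hx2
  exact ⟨X, hsol, hsmooth, huniq⟩

/-- **Refuter-facing form of the entry** (audit 2026-08-16): at the three-dimensional scaling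
`β = 5/2`, EVERY weak solution (BMR Def. 3.1: C¹ components solving (1.1) on `[0, ∞)`) of the
scalar Katz–Pavlović cascade launched by a non-negative square-summable datum is non-negative and
smooth for positive times — all weighted suprema `supₙ λₙ^γ Yₙ(t)`, `γ > 0`, `t > 0`, are finite —
because it coincides with BMR's solution by the uniqueness clause of Theorem 1 (Prop. 3.2). So a
blow-up thesis exhibiting any weak solution of this model from such a datum that loses smoothness is
refuted by the entry. [cite: BarbatoMorandinRomito2011, §1.1 Thm. 1 and §3 Prop. 3.2]
[cite: Tao2016AveragedNS, §1.2 p. 9] -/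
theorem DyadicCascadeRegularity.weakSolution_smooth (h : DyadicCascadeRegularity)
    {ν : ℝ} (hν : 0 < ν) {x : ℕ → ℝ} (hx : ∀ n, 1 ≤ n → 0 ≤ x n)
    (hx2 : Summable fun n => x n ^ 2) {Y : ℕ → ℝ → ℝ} (hY : IsBMRWeakSolution ν (5 / 2) x Y) :
    (∀ n, 1 ≤ n → ∀ t, 0 ≤ t → 0 ≤ Y n t) ∧
      ∀ γ : ℝ, 0 < γ → ∀ t : ℝ, 0 < t → ∃ C : ℝ, ∀ n, 1 ≤ n → bmrLambda n ^ γ * Y n t ≤ C := by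
  obtain ⟨X, -, -, hpos, hsmooth, huniq⟩ := h ν (5 / 2) hν (by norm_num) le_rfl x hx hx2
  refine ⟨fun n hn t ht => ?_, fun γ hγ t ht => ?_⟩
  · rw [huniq Y hY n hn t ht]
    exact hpos n hn t ht
  · obtain ⟨C, hC⟩ := hsmooth γ hγ t ht
    exact ⟨C, fun n hn => by rw [huniq Y hY n hn t ht.le]; exact hC n hn⟩

end Literature.Barriers.NavierStokesRegularity
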